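import Summits.HodgeConjecture.HodgeConjecture.Theses.LinearSystemTorelli
import Literature.Barriers.HodgeConjecture.GeneralizedHodgeTrivialReasonsSubHodgeProofs
import Literature.AlgebraicGeometry.HodgeTheory.ComplexGysinHodgeType
import Literature.AlgebraicGeometry.HodgeTheory.ComplexConjugationHolds
import Literature.AlgebraicGeometry.HodgeTheory.HodgeFiltrationModelsReductionProofs
import Literature.NumberTheory.Transcendental.DeRhamTheoremMultiplicative

/-!
# Crux `TranscendentalOrSupported` (stmt-HodgeConjecture-10853), line `Sketch` — stub
# `stub_gysinRangeSubHodge`: the image of a Gysin morphism is a sub-Hodge structure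

Helper file for the line skeleton (v6, isotypic bootstrap in Gysin form) of the crux
`TranscendentalOrSupported` of route `LinearSystemTorelli` (GHC(2p, coniveau 1) in Grothendieck's
sub-Hodge form), registered stub `stub_gysinRangeSubHodge`. Notation: `g : Y ⟶ X` a morphism of
smooth projective complex varieties of dimensions `m ≤ n`, `μ` an orientation family,
`g_* = complexGysin μ hY hX g hab : Hᵃ(Y(ℂ); ℂ) → Hᵇ(X(ℂ); ℂ)` (`a + 2n = b + 2m`) its Gysin morphism,
`A` a Hodge model of `X` (`A.pullback b = A^* : Hᵇ(X(ℂ); ℂ) → Hᵇ(X^an; ℂ)` the bijective comparison,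
`A.hodgePQ b p' q' = H^{p',q'}` the pieces of its Hodge decomposition).

CLAIM (`stub_gysinRangeSubHodge`; Grothendieck, Topology 8 (1969), p. 300: "As the previous
homomorphisms are compatible with the Hodge structures, the assertion follows"). The image of `g_*`,
pulled back to `A`, is a sub-Hodge structure:
`(im g_*).map A^* = ⨆_{p'+q'=b} (im g_*).map A^* ⊓ H^{p',q'}`.

PROOF (Voisin I, §7.3.2 with §7.3.1 (7.5)). Choose a Hodge model `B` of `Y`
(`nonempty_hodgeModel_holds`). The Gysin morphism `g_*` has bidegree `(n - m, n - m)` on Hodge types: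
a class `y ∈ Hᵃ(Y(ℂ); ℂ)` of type `(p, q)` (witnessed by `B`) goes to a class `g_* y` of type
`(p + (n - m), q + (n - m))` (`isOfHodgeType_complexGysin`, fed with the theorems
`hodgePQ_independent_of_hodgeModel_holds`, `nonempty_hodgeModel_holds` and de Rham's theorem in
multiplicative form `exists_deRhamIsoFamily_holds`), and this type may be read in the fixed model `A`
(`hodgePQ_independent_of_hodgeModel_holds.isOfHodgeType_iff`). The image of such a type-shifting map,
pulled back to `A`, is a sub-Hodge structure (`HodgeModel.IsSubHodge.map_range_of_hodgePQ`), and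
`A.IsSubHodge b _` is the displayed equation by definition. The degree bookkeeping
`p' + q' = a + 2 (n - m) = b` uses `m ≤ n`.

Pure tree theorems; no named fact is taken as a hypothesis and none is introduced.

References: A. Grothendieck, *Hodge's general conjecture is false for trivial reasons*, Topology 8
(1969), p. 300; C. Voisin, *Hodge Theory and Complex Algebraic Geometry I* (CUP 2002), §7.3.1 (7.5)
and §7.3.2 (with Lemma 7.30).
-/

-- `Summit.HodgeConjecture.HodgeConjecture.Theorems` is the mandated namespace (single-conjunct summit:
-- Sub = Summit), which `linter.dupNamespace` flags on every declaration; the lakefile turns the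
-- linter off tree-wide (weak option), restated here so stand-alone elaboration is warning-free too.
set_option linter.dupNamespace false

noncomputable section

namespace Summit.HodgeConjecture.HodgeConjecture.Theorems

open CategoryTheory
open Literature.AlgebraicGeometry.Motives Literature.AlgebraicGeometry.HodgeTheory
open Literature.AlgebraicTopology.SingularHomology

variable {m n : ℕ} {Y X : SchemeOver ℂ}

/-! ### The bidegree of a Gysin morphism, read in a fixed Hodge model -/

/-- **A Gysin morphism shifts Hodge types by `(n - m, n - m)`, read in fixed Hodge models.** For
`g : Y ⟶ X` (smooth projective, dimensions `m ≤ n`), an orientation family `μ`, degrees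
`a + 2n = b + 2m`, Hodge models `B` of `Y` and `A` of `X`, and a class `y ∈ Hᵃ(Y(ℂ); ℂ)` with
`B^* y ∈ H^{p,q}`: `A^* (g_* y) ∈ H^{p + (n - m), q + (n - m)}`. This is `isOfHodgeType_complexGysin`
("`φ_*` is a morphism of Hodge structures of bidegree `(r, r)`", Voisin I §7.3.2), fed with the
theorems `hodgePQ_independent_of_hodgeModel_holds`, `nonempty_hodgeModel_holds`,
`exists_deRhamIsoFamily_holds`, its `∃`-over-models conclusion being read in `A` by
`hodgePQ_independent_of_hodgeModel_holds.isOfHodgeType_iff`.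
[cite: VoisinHodgeI2002, §7.3.2 (with Lemma 7.30)] -/
theorem gysinRangeSubHodge_pullback_mem_hodgePQ (μ : OrientationFamily) (hY : IsSmoothProjective m Y)
    (hX : IsSmoothProjective n X) (B : HodgeModel m Y) (A : HodgeModel n X) (g : Y ⟶ X) {a b : ℕ}
    (hab : a + 2 * n = b + 2 * m) (hmn : m ≤ n) {p q : ℕ} {y : complexBetti Y a}
    (hy : B.pullback a y ∈ B.hodgePQ a p q) :
    A.pullback b (complexGysin μ hY hX g hab y) ∈ A.hodgePQ b (p + (n - m)) (q + (n - m)) :=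
  (hodgePQ_independent_of_hodgeModel_holds.isOfHodgeType_iff hX A).1
    (isOfHodgeType_complexGysin hodgePQ_independent_of_hodgeModel_holds
      (fun _ _ ↦ nonempty_hodgeModel_holds)
      (fun E _ _ _ ↦ Literature.NumberTheory.Transcendental.exists_deRhamIsoFamily_holds (E := E))
      μ hY hX g hab (p := p) (q := q) (by omega) (by omega) ⟨B, hy⟩)

/-! ### The stub -/

/-- **STUB `stub_gysinRangeSubHodge` (the image of a Gysin morphism is a sub-Hodge structure) of the
crux `TranscendentalOrSupported`, line `Sketch`** — Grothendieck (1969), p. 300: "the previous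
homomorphisms are compatible with the Hodge structures". For a morphism `g : Y ⟶ X` of smooth
projective varieties of dimensions `m ≤ n`, every orientation family `μ`, degrees `a + 2n = b + 2m`
and every Hodge model `A` of `X`, the image of `g_* = complexGysin μ hY hX g hab` pulled back to `A`
is a sub-Hodge structure: `(im g_*).map A^* = ⨆_{p'+q'=b} (im g_*).map A^* ⊓ H^{p',q'}`. Proof:
choose a Hodge model `B` of `Y` (`nonempty_hodgeModel_holds`); `g_*` sends classes of type `(p, q)`
(in `B`) to classes of type `(p + (n - m), q + (n - m))` (in `A`)
(`gysinRangeSubHodge_pullback_mem_hodgePQ`), with `p + q = a → p' + q' = b` by `m ≤ n`; the image of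
a type-shifting map is a sub-Hodge structure (`HodgeModel.IsSubHodge.map_range_of_hodgePQ`), whose
conclusion `A.IsSubHodge b _` is this equation by definition. [cite: GrothendieckTopology1969, p. 300]
[cite: VoisinHodgeI2002, §7.3.1 (7.5) and §7.3.2] -/
theorem stub_gysinRangeSubHodge :
    ∀ (μ : OrientationFamily) ⦃m n : ℕ⦄ ⦃Y X : SchemeOver ℂ⦄ (hY : IsSmoothProjective m Y)
    (hX : IsSmoothProjective n X) (A : HodgeModel n X) (g : Y ⟶ X) ⦃a b : ℕ⦄
    (hab : a + 2 * n = b + 2 * m), m ≤ n →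
    (LinearMap.range (complexGysin μ hY hX g hab)).map (A.pullback b).hom =
      ⨆ (p' : ℕ) (q' : ℕ) (_ : p' + q' = b),
        (LinearMap.range (complexGysin μ hY hX g hab)).map (A.pullback b).hom ⊓ A.hodgePQ b p' q' := by
  intro μ m n Y X hY hX A g a b hab hmn
  -- a Hodge model of `Y`
  obtain ⟨B⟩ := (nonempty_hodgeModel_holds (n := m) (X := Y)).nonempty hY
  -- the image of the type-shifting map `g_*` is a sub-Hodge structure
  have h : A.IsSubHodge b ((LinearMap.range (complexGysin μ hY hX g hab)).map (A.pullback b).hom) :=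
    HodgeModel.IsSubHodge.map_range_of_hodgePQ B A (complexGysin μ hY hX g hab)
      fun p q hpq ↦ ⟨p + (n - m), q + (n - m), by omega,
        fun _ hy ↦ gysinRangeSubHodge_pullback_mem_hodgePQ μ hY hX B A g hab hmn hy⟩
  exact h

end Summit.HodgeConjecture.HodgeConjecture.Theorems

end
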